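import Literature.NumberTheory.NumberFields.EisensteinFieldLocal
import Literature.NumberTheory.NumberFields.EisensteinFieldPrimes
import Mathlib.RingTheory.Ideal.Norm.AbsNorm
import HarnessLib

/-!
# The place `(q)` of `ℚ(ζ₃)` at an inert rational prime `q ≡ 2 (mod 3)`: membership, norm `q²`, and the
# valuations of rationals — the dischargers of a KILLING place of the `3`-isogeny descent

Topic `NumberTheory/NumberFields`; namespace `Literature.NumberTheory.NumberFields.K3`. For the booking form
`CPMuDescent.shaCorank_three_eq_zero_of_gens_of_nodeKill` (file `CPMuDescentK3BoxNodeKill`) a per-curve certificate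
has to supply, for one inert prime `q ∣ s` with `q ∤ 6N` and `q ≢ ±1 (mod 9)`, the place `w₀ = (q)` of `K3 = ℚ(ζ₃)`
together with `3N ∉ w₀`, `w₀(2) = 1`, `w₀(s) < 1` and `9 ∤ N(w₀) − 1 = q² − 1`. All four are reduced here to
divisibilities in `ℕ` (Ireland–Rosen Prop. 9.1.4: `(q)` is prime of norm `q²`):

* `natCast_mem_placeOfPrime_iff` — `n ∈ (q) ↔ q ∣ n` for `n : ℕ`;
* `absNorm_placeOfPrime_natCast` — `N((q)) = q²`;
* `valuation_placeOfPrime_ratCast_lt_one_of_dvd` — `w₀(A/B) < 1` for naturals `A, B` with `q ∣ A`, `q ∤ B`, `A ≠ 0`;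
* `valuation_placeOfPrime_natCast_eq_one` — `w₀(c) = 1` for `q ∤ c` (restated from `EisensteinFieldLocal`).

## References
* [IrelandRosen1990] K. Ireland, M. Rosen, *A Classical Introduction to Modern Number Theory*, 2nd ed., GTM 84, Ch. 9
  §1, Prop. 9.1.4 (inert primes of `ℤ[ω]` have residue field of order `q²`).
-/

noncomputable section

open NumberField IsDedekindDomain IsDedekindDomain.HeightOneSpectrum

namespace Literature.NumberTheory.NumberFields

namespace K3

section InertPlace

variable {q : ℕ} (hq : Prime ((q : ℕ) : 𝓞 K3))

/-- The ideal of the place `(q)` is `span {q}`. [cite: IrelandRosen1990, Prop. 9.1.4] -/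
theorem placeOfPrime_asIdeal : (placeOfPrime hq).asIdeal = Ideal.span {((q : ℕ) : 𝓞 K3)} := rfl

/-- **`n ∈ (q) ↔ q ∣ n`** for a natural number `n` and an inert prime `q`. [cite: IrelandRosen1990, Prop. 9.1.4] -/
theorem natCast_mem_placeOfPrime_iff (n : ℕ) : ((n : ℕ) : 𝓞 K3) ∈ (placeOfPrime hq).asIdeal ↔ q ∣ n := by
  rw [placeOfPrime_asIdeal, Ideal.mem_span_singleton, show ((n : ℕ) : 𝓞 K3) = mkInt n 0 by
    rw [mkInt_intCast, Int.cast_natCast], natCast_dvd_mkInt_iff]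
  constructor
  · rintro ⟨h, -⟩; exact_mod_cast h
  · intro h; exact ⟨by exact_mod_cast h, dvd_zero _⟩

/-- **`N((q)) = q²`** for an inert prime `q`. [cite: IrelandRosen1990, Prop. 9.1.4] -/
theorem absNorm_placeOfPrime_natCast : Ideal.absNorm (placeOfPrime hq).asIdeal = q ^ 2 := by
  rw [placeOfPrime_asIdeal, show ((q : ℕ) : 𝓞 K3) = mkInt q 0 by rw [mkInt_intCast, Int.cast_natCast],
    absNorm_span_mkInt]
  simp [sq, Int.natAbs_mul]

/-- **`w₀(A/B) < 1`** at `w₀ = (q)` for naturals with `q ∣ A ≠ 0`, `q ∤ B` (e.g. `s = A/2`, `q ∣ A` odd).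
[cite: IrelandRosen1990, Prop. 9.1.4] -/
theorem valuation_placeOfPrime_ratCast_lt_one_of_dvd [Fact q.Prime] {x : ℚ} {A B : ℕ} (hA : q ∣ A)
    (hB : ¬ q ∣ B) (hx : x = A / B ∨ x = -(A / B)) :
    (placeOfPrime hq).valuation K3 (algebraMap ℚ K3 x) < 1 := by
  have hvA : (placeOfPrime hq).valuation K3 (A : K3) < 1 := by
    have hdvd : ((q : ℕ) : 𝓞 K3) ∣ ((A : ℕ) : 𝓞 K3) := Nat.cast_dvd_cast hA
    rw [← coe_natCast_ringOfIntegers]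
    exact (val_coe_lt_one_iff hq _).mpr hdvd
  have hvB : (placeOfPrime hq).valuation K3 (B : K3) = 1 := val_natCast_of_not_dvd hq hB
  have e : (placeOfPrime hq).valuation K3 (algebraMap ℚ K3 (A / B)) < 1 := by
    rw [map_div₀, map_natCast, map_natCast, map_div₀, hvB, div_one]; exact hvA
  rcases hx with rfl | rfl
  · exact e
  · rw [map_neg, Valuation.map_neg]; exact e

/-- `w₀(c) = 1` for a natural `c` with `q ∤ c` (e.g. `c = 2`). [cite: IrelandRosen1990, Prop. 9.1.4] -/
theorem valuation_placeOfPrime_natCast_eq_one [Fact q.Prime] {c : ℕ} (hc : ¬ q ∣ c) :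
    (placeOfPrime hq).valuation K3 (c : K3) = 1 := val_natCast_of_not_dvd hq hc

end InertPlace

end K3

end Literature.NumberTheory.NumberFields

end
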